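import Literature.AlgebraicGeometry.Motives.AlgPointsProofs
import Literature.AlgebraicGeometry.Motives.AlgPointsProperProofs
import Literature.NumberTheory.Transcendental.AnalytificationFunctorialityProofs
import Literature.NumberTheory.Transcendental.AnalytificationSeparatedProofs
import Mathlib.Topology.Separation.Profinite
import Mathlib.Topology.MetricSpace.Ultra.TotallySeparated
import HarnessLib

/-!
# `X(L)` is totally disconnected for `L` a totally disconnected local field (proof file)

Sibling proof file of `Literature/AlgebraicGeometry/Motives/AlgPoints.lean` (the strong topology
`AlgPoints.instTopologicalSpace` on the `L`-points `X(L)` of a `k`-scheme `X`).  For a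
non-archimedean local field `L` (more generally: any locally compact non-trivially normed field
`L ⊇ k` whose topology is totally disconnected) and `X` separated and locally of finite type over
`k`, the space `X(L)` is **totally disconnected**; together with the tree's PROVED named facts
`compactSpace_algPoints_of_isProper_holds` (`X` proper ⇒ `X(L)` compact) and
`t2Space_algPoints_holds` (`X` separated ⇒ `X(L)` Hausdorff) this says that `X(L)` is a
**profinite space** for `X` proper over `k` — e.g. the Mordell–Weil group `A(K)` of an abelian
variety over a finite extension `K` of `ℚ_p` is a profinite (abelian) group
(`AlgPoints.isTopologicalGroup`).

The printed sources: J.-P. Serre, *Lie Algebras and Lie Groups* (1964), Part II "Lie Groups",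
Chap. II ("Analytic manifolds" over a complete non-archimedean field — locally closed subsets of
`Lⁿ` inherit a totally disconnected topology); B. Conrad, *Weil and Grothendieck approaches to
adelic points*, Enseign. Math. **58** (2012), Prop. 2.1 (for `X = Spec A` affine of finite type,
a presentation `A = k[t₁, …, tₙ]/I` identifies `X(L)` *as a topological space* with the zero set
of `I` in `Lⁿ`), Prop. 3.1 (the topology on `X(L)` is glued from the affine opens `U(L)`, which
are open in `X(L)`) and §5 (local fields: `X(L)` is a locally compact Hausdorff, totally
disconnected space).  We follow exactly this route:

* `AlgPoints.isTotallyDisconnected_setOf_pt_mem` — an affine chart `U(L) ⊆ X(L)` is totally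
  disconnected whenever `L` is: the coordinate map `(t₁, …, tₙ) : U(L) → Lⁿ` is continuous and
  INJECTIVE (`AlgPoints.ext_of_forall_eval_eq`: a point of an affine open is determined by the
  values of the regular functions, which are polynomials in the coordinates,
  `AlgPoints.exists_eval_eq_mvPolynomial_eval`), and a continuous injection into a totally
  disconnected space has totally disconnected source (Mathlib `isTotallyDisconnected_of_image`).
  No separation or topological-ring hypothesis on `L` is needed for this step.
* `totallyDisconnectedSpace_of_isOpen_cover` (pure topology) — a LOCALLY COMPACT HAUSDORFF space
  covered by totally disconnected open subsets is totally disconnected: a compact neighbourhood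
  inside such an open set is a compact Hausdorff totally disconnected space, hence has a basis of
  clopen sets (Mathlib `isTopologicalBasis_isClopen`); a clopen neighbourhood obtained this way is
  clopen in the whole space, so every connected component lies inside one member of the cover.
  (Local compactness is used in an essential way: "locally totally disconnected" does not imply
  "totally disconnected" for general spaces.)
* `AlgPoints.totallyDisconnectedSpace_of_locallyCompactSpace` and the named-instance forms
  `totallyDisconnectedSpace_algPoints` (`L` locally compact non-trivially normed and totally
  disconnected, `X` separated and locally of finite type: uses the tree's
  `locallyCompactSpace_algPoints_holds` and `t2Space_algPoints_holds`) and
  `compactSpace_t2Space_totallyDisconnectedSpace_algPoints_of_isProper`.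

Everything is proved; there are no new definitions.  HONEST SCOPE: nothing here is specific to
abelian varieties or to any arithmetic application; the file only records the point-set topology
of `X(L)` over a totally disconnected local field.

## References

* B. Conrad, *Weil and Grothendieck approaches to adelic points*, Enseign. Math. (2) **58**
  (2012), 61–97, Prop. 2.1, Prop. 3.1, §5. [ConradAdelicPoints2012]
* J.-P. Serre, *Géométrie algébrique et géométrie analytique*, Ann. Inst. Fourier **6** (1956),
  §2 n°5 Lemme 1 (the chart lemma, for `L = ℂ`). [SerreGAGA1956]
* D. Mumford, *The Red Book of Varieties and Schemes*, I §10. [MumfordRedBook1999]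
-/

noncomputable section

universe u

open CategoryTheory AlgebraicGeometry TopologicalSpace
open _root_.Topology

namespace Literature.AlgebraicGeometry.Motives

/-! ### Local-to-global: locally compact Hausdorff spaces covered by totally disconnected opens -/

/-- **A locally compact Hausdorff space covered by totally disconnected open subsets is totally
disconnected.**  If every point `x` of a locally compact Hausdorff space `T` has an open
neighbourhood `s` which is totally disconnected (as a subset), then `T` is totally disconnected:
choose a compact neighbourhood `K ⊆ s` of `x`; `K` is compact Hausdorff and totally disconnected,
so (Mathlib `isTopologicalBasis_isClopen`) `x` has a neighbourhood `V ⊆ interior K` clopen in `K`;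
such a `V` is compact, hence closed in `T`, and open in `T`, so the connected component of `x`
lies in `V ⊆ s` and is a point.  (Used with the affine charts of `X(L)`, Conrad 2012 Prop. 3.1.)
Private point-set helper. [folklore] -/
private theorem totallyDisconnectedSpace_of_isOpen_cover {T : Type*} [TopologicalSpace T]
    [LocallyCompactSpace T] [T2Space T]
    (h : ∀ x : T, ∃ s : Set T, IsOpen s ∧ x ∈ s ∧ IsTotallyDisconnected s) :
    TotallyDisconnectedSpace T := by
  rw [totallyDisconnectedSpace_iff_connectedComponent_subsingleton]
  intro x
  obtain ⟨s, hs, hxs, hstd⟩ := h x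
  -- a compact neighbourhood `K ⊆ s` of `x`
  obtain ⟨K, hKx, hKs, hKc⟩ := local_compact_nhds (hs.mem_nhds hxs)
  have hxK : x ∈ K := mem_of_mem_nhds hKx
  have hxint : x ∈ interior K := mem_interior_iff_mem_nhds.2 hKx
  -- `K` is a compact Hausdorff totally disconnected space: clopen sets form a basis
  haveI : CompactSpace K := isCompact_iff_compactSpace.mp hKc
  haveI : TotallyDisconnectedSpace K :=
    totallyDisconnectedSpace_subtype_iff.2 fun t ht hpre => hstd t (ht.trans hKs) hpre
  obtain ⟨V', hV'clopen, hxV', hV'sub⟩ :=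
    (isTopologicalBasis_isClopen (X := K)).exists_subset_of_mem_open
      (a := (⟨x, hxK⟩ : K)) (u := Subtype.val ⁻¹' interior K) hxint
      (isOpen_interior.preimage continuous_subtype_val)
  -- `V := V'` viewed in `T` is clopen in `T`
  set V : Set T := Subtype.val '' V'
  have hVclosed : IsClosed V :=
    (hV'clopen.1.isCompact.image continuous_subtype_val).isClosed
  have hVopen : IsOpen V := by
    obtain ⟨O, hO, hOV'⟩ := isOpen_induced_iff.mp hV'clopen.2
    have hVO : V = O ∩ interior K := by
      ext y
      constructor
      · rintro ⟨y', hy', rfl⟩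
        refine ⟨?_, hV'sub hy'⟩
        rw [← hOV'] at hy'
        exact hy'
      · rintro ⟨hyO, hyint⟩
        refine ⟨⟨y, interior_subset hyint⟩, ?_, rfl⟩
        rw [← hOV']
        exact hyO
    rw [hVO]
    exact hO.inter isOpen_interior
  have hxV : x ∈ V := ⟨⟨x, hxK⟩, hxV', rfl⟩
  have hVs : V ⊆ s := by
    rintro _ ⟨y', -, rfl⟩
    exact hKs y'.2
  -- the connected component of `x` lies in the clopen `V ⊆ s`, hence is a subsingleton
  exact hstd _ ((IsClopen.connectedComponent_subset ⟨hVclosed, hVopen⟩ hxV).trans hVs)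
    isPreconnected_connectedComponent

namespace AlgPoints

variable {k : Type u} [Field k] {X : SchemeOver k} {L : Type u} [Field L] [Algebra k L]

/-! ### Affine charts are totally disconnected -/

section Chart

variable [TopologicalSpace L]

/-- **An affine chart `U(L) ⊆ X(L)` is totally disconnected when `L` is** (Conrad 2012,
Prop. 2.1: for `U = Spec A` of finite type, `U(L) ⊆ Lⁿ` as a topological space; Serre, GAGA §2
n°5 Lemme 1 for the chart).  For `X` locally of finite type over `k`, `U ⊆ X` an affine open and
`L ⊇ k` any field with a totally disconnected topology: choosing generators `x₁, …, xₙ` of the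
`k`-algebra `Γ(X, U)` (`AlgPoints.exists_eval_eq_mvPolynomial_eval`), the coordinate map
`Q ↦ (x₁(Q), …, xₙ(Q)) : U(L) → Lⁿ` is continuous (each `xⱼ` is continuous for the strong
topology) and injective (every regular function is a polynomial in the `xⱼ`, and an `L`-point of
an affine open is determined by the values of the regular functions,
`AlgPoints.ext_of_forall_eval_eq`); a continuous injection into the totally disconnected space
`Lⁿ` has totally disconnected source (Mathlib `isTotallyDisconnected_of_image`).  No separation
or topological-ring hypothesis on `L` is used. [cite: ConradAdelicPoints2012, Prop. 2.1] -/
theorem isTotallyDisconnected_setOf_pt_mem [TotallyDisconnectedSpace L] [LocallyOfFiniteType X.hom]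
    {U : X.left.Opens} (hU : IsAffineOpen U) :
    IsTotallyDisconnected {P : AlgPoints X L | P.pt ∈ U} := by
  obtain ⟨n, x, hx⟩ := exists_eval_eq_mvPolynomial_eval (L := L) hU
  -- the coordinate map of the chart
  let c : {P : AlgPoints X L // P.pt ∈ U} → (Fin n → L) := fun Q j => Q.1.eval U Q.2 (x j)
  have hc : Continuous c := by
    refine continuous_pi fun j => continuous_def.mpr fun V hV => ?_
    have hpre : (fun Q : {P : AlgPoints X L // P.pt ∈ U} => Q.1.eval U Q.2 (x j)) ⁻¹' V =
        Subtype.val ⁻¹' basicSet U (x j) V := by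
      ext Q
      exact ⟨fun h => ⟨Q.2, h⟩, fun ⟨_, h⟩ => h⟩
    rw [hpre]
    exact (isOpen_basicSet U (x j) hV).preimage continuous_subtype_val
  have hinj : Function.Injective c := by
    intro P Q hPQ
    apply Subtype.ext
    refine ext_of_forall_eval_eq hU P.2 Q.2 fun a => ?_
    obtain ⟨p, hp⟩ := hx a
    rw [hp P.1 P.2, hp Q.1 Q.2]
    exact congrArg (fun v : Fin n → L => MvPolynomial.eval v p) hPQ
  have huniv : IsTotallyDisconnected (Set.univ : Set {P : AlgPoints X L // P.pt ∈ U}) :=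
    isTotallyDisconnected_of_image hc.continuousOn hinj
      (isTotallyDisconnected_of_totallyDisconnectedSpace _)
  exact totallyDisconnectedSpace_subtype_iff.1 ⟨huniv⟩

/-- **`X(L)` is totally disconnected** for `X` locally of finite type over `k` and `L ⊇ k` a field
with a totally disconnected topology, PROVIDED `X(L)` is locally compact and Hausdorff (e.g. `L` a
local field and `X` separated, see `totallyDisconnectedSpace_algPoints`): `X(L)` is covered by the
open (`AlgPoints.isOpen_setOf_pt_mem`) totally disconnected
(`isTotallyDisconnected_setOf_pt_mem`) charts `U(L)`, `U ⊆ X` affine open, and a locally compact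
Hausdorff space covered by totally disconnected opens is totally disconnected
(`totallyDisconnectedSpace_of_isOpen_cover`).  (Conrad 2012, Prop. 3.1 and §5.)
[cite: ConradAdelicPoints2012, Prop. 3.1] -/
theorem totallyDisconnectedSpace_of_locallyCompactSpace [TotallyDisconnectedSpace L]
    [LocallyOfFiniteType X.hom] [LocallyCompactSpace (AlgPoints X L)] [T2Space (AlgPoints X L)] :
    TotallyDisconnectedSpace (AlgPoints X L) := by
  refine totallyDisconnectedSpace_of_isOpen_cover fun P => ?_
  obtain ⟨_, ⟨U, hU, rfl⟩, hPU, -⟩ :=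
    X.left.isBasis_affineOpens.exists_subset_of_mem_open (Set.mem_univ P.pt) isOpen_univ
  exact ⟨{Q : AlgPoints X L | Q.pt ∈ U}, isOpen_setOf_pt_mem U, hPU,
    isTotallyDisconnected_setOf_pt_mem hU⟩

/-- The compact Hausdorff variant of `totallyDisconnectedSpace_of_locallyCompactSpace`: if `X(L)`
is compact Hausdorff (e.g. `X` proper over `k` and `L` a local field), `X` is locally of finite
type and `L` is totally disconnected, then `X(L)` is totally disconnected — a profinite space.
[cite: ConradAdelicPoints2012, Prop. 3.1] -/
theorem totallyDisconnectedSpace_of_compactSpace [TotallyDisconnectedSpace L]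
    [LocallyOfFiniteType X.hom] [CompactSpace (AlgPoints X L)] [T2Space (AlgPoints X L)] :
    TotallyDisconnectedSpace (AlgPoints X L) :=
  totallyDisconnectedSpace_of_locallyCompactSpace

end Chart

end AlgPoints

/-! ### Named-instance forms over totally disconnected local fields -/

section LocalField

variable {k : Type u} [Field k]

/-- **`X(L)` is totally disconnected over a totally disconnected local field** (Conrad 2012, §5
with Prop. 2.1 / 3.1; Serre, *Lie Algebras and Lie Groups*, Part II Chap. II for the affine
pieces).  For `X` separated and locally of finite type over `k` and `L ⊇ k` a locally compact,
non-trivially normed field whose topology is totally disconnected (every non-archimedean local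
field: an ultrametric space is totally separated), the space `X(L)` with its strong topology is
totally disconnected.  Inputs, all PROVED in the tree: `X(L)` is locally compact
(`locallyCompactSpace_algPoints_holds`) and Hausdorff
(`Literature.NumberTheory.Transcendental.t2Space_algPoints_holds`), and the chart argument
`AlgPoints.totallyDisconnectedSpace_of_locallyCompactSpace`.
[cite: ConradAdelicPoints2012, Prop. 3.1 and §5] -/
theorem totallyDisconnectedSpace_algPoints (X : SchemeOver k) (L : Type u) [NontriviallyNormedField L]
    [Algebra k L] [LocallyCompactSpace L] [TotallyDisconnectedSpace L] [IsSeparated X.hom]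
    [LocallyOfFiniteType X.hom] : TotallyDisconnectedSpace (AlgPoints X L) := by
  haveI : LocallyCompactSpace (AlgPoints X L) := locallyCompactSpace_algPoints_holds X L
  haveI : T2Space (AlgPoints X L) :=
    Literature.NumberTheory.Transcendental.t2Space_algPoints_holds X L
  exact AlgPoints.totallyDisconnectedSpace_of_locallyCompactSpace

/-- The same over an **ultrametric** locally compact non-trivially normed field `L` (e.g. `ℚ_p`
and its finite extensions): the hypothesis `TotallyDisconnectedSpace L` of
`totallyDisconnectedSpace_algPoints` is automatic, an ultrametric space being totally separated
(Mathlib). [cite: ConradAdelicPoints2012, Prop. 3.1 and §5] -/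
theorem totallyDisconnectedSpace_algPoints_of_isUltrametricDist (X : SchemeOver k) (L : Type u)
    [NontriviallyNormedField L] [IsUltrametricDist L] [Algebra k L] [LocallyCompactSpace L]
    [IsSeparated X.hom] [LocallyOfFiniteType X.hom] : TotallyDisconnectedSpace (AlgPoints X L) :=
  totallyDisconnectedSpace_algPoints X L

/-- **`X(L)` is a profinite space for `X` proper** over `k` and `L ⊇ k` a totally disconnected,
locally compact, non-trivially normed field: compact (the tree's
`compactSpace_algPoints_of_isProper_holds`, Conrad §5 / Mumford *Red Book* I.10 Thm. 2), Hausdorff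
(`t2Space_algPoints_holds`) and totally disconnected (`totallyDisconnectedSpace_algPoints`; a
proper morphism is separated and locally of finite type).  Recorded as the conjunction of the three
instances. [cite: ConradAdelicPoints2012, §5] -/
theorem compactSpace_t2Space_totallyDisconnectedSpace_algPoints_of_isProper (X : SchemeOver k)
    (L : Type u) [NontriviallyNormedField L] [Algebra k L] [LocallyCompactSpace L]
    [TotallyDisconnectedSpace L] [IsProper X.hom] :
    CompactSpace (AlgPoints X L) ∧ T2Space (AlgPoints X L) ∧
      TotallyDisconnectedSpace (AlgPoints X L) :=
  ⟨compactSpace_algPoints_of_isProper_holds X L,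
    Literature.NumberTheory.Transcendental.t2Space_algPoints_holds X L,
    totallyDisconnectedSpace_algPoints X L⟩

end LocalField

end Literature.AlgebraicGeometry.Motives
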